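import Literature.Geometry.Symplectic.LefschetzSteinOpenBookBaseCase
import Literature.Geometry.Symplectic.LefschetzSteinOpenBookTransport
import Literature.Topology.FourManifolds.MultiAttachmentDataMap
import HarnessLib

/-!
# PALF ⇒ Stein with supported boundary open book: the Kas open book on a diffeomorphic copy of
# the base

Topic `Literature/Geometry/Symplectic`; a proofs-only companion (one instance, no definition, no named fact) of
`LefschetzSteinOpenBookBaseCase.lean` and `LefschetzSteinOpenBookTransport.lean` for the named
fact `Literature.Geometry.Symplectic.palf_stein_supportedByBoundaryOpenBook` (Akbulut–Ozbagci 2001,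
Thm. 5), handle-free case `h = ∅`.  The Stein models of the base are diffeomorphic COPIES
`e : Base g ≅ X₀` of `Base g` (the rounded convex model of `LefschetzBaseModelStein.lean`,
`exists_steinStructure_model_orient`; or `LefschetzBaseSteinModel.Model g` once identified).
Here such a copy is equipped with the data which `palf_stein_supportedByBoundaryOpenBook_of_reebModels`
asks for besides the Stein structure and the Reeb field:

* `exists_multiAttachmentData_isKasOpenBookOf_copy` — for the empty family `h₀` of attaching
  maps, ANY `X₀` with a diffeomorphism `e : Base g ≅ X₀` and ANY boundary datum `bX₀` of `X₀`:
  the multi-attachment datum `D₀ = D_base.map e` (`jA = e ∘ incl`, no handles;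
  `MultiAttachmentData.map`) and the transported boundary open book
  `ob₀ = (∂e)_* (LefschetzBase.boundaryOpenBook g)` (`OpenBook.map` along
  `∂e = (bBase g).restrictDiffeomorph bX₀ e`), which IS the Kas open book of `(D₀, bX₀)`
  (`IsKasOpenBookOf`, by `IsKasOpenBookOf.map` from the base case
  `exists_multiAttachmentData_isKasOpenBookOf_base`).

## References
* S. Akbulut, B. Ozbagci, *Lefschetz fibrations on compact Stein surfaces*, Geom. Topol. 5
  (2001), Thm. 5 and its proof. [AkbulutOzbagci2001]
* A. Kas, *On the handlebody decomposition associated to a Lefschetz fibration*, Pacific J.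
  Math. 89 (1980), 89–104. [Kas1980]
-/

noncomputable section

open scoped Manifold ContDiff Topology
open Set Function

namespace Literature.Geometry.Symplectic

open Literature.Topology.FourManifolds Literature.Topology.FourManifolds.HandleAttachingMap
  Literature.Topology.FourManifolds.LefschetzBase

/-- The boundary `3`-manifold of the base is Hausdorff (it embeds in `Base g ⊂ ℝ⁴`); an
instance, needed to transport open books along diffeomorphisms of it (`OpenBook.map`).
[folklore] -/
instance t2Space_bBase_carrier (g : ℕ) : T2Space (bBase g).carrier :=
  (bBase g).isSmoothEmbedding.isEmbedding.t2Space

/-- **The Kas open book on a diffeomorphic copy of the base.**  For the empty family `h₀` of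
2-handle attaching maps on `Base g`, a manifold `X₀` with a diffeomorphism `e : Base g ≅ X₀` and a
boundary datum `bX₀` of `X₀`, there is a multi-attachment datum `D₀` of `h₀` on `X₀` with
`D₀.jA = e ∘ incl` such that the open book `(∂e)_* (boundaryOpenBook g)` on `bX₀.carrier`
(binding `e({w = 0} ∩ ∂ Base g)`, fibration `w/‖w‖ ∘ e⁻¹`) is the Kas open book of `(D₀, bX₀)`.
[cite: Kas1980] -/
theorem exists_multiAttachmentData_isKasOpenBookOf_copy (g : ℕ)
    (h₀ : Empty → HandleAttachingMap 3 2 (Base g))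
    {X₀ : Type} [TopologicalSpace X₀] [T2Space X₀] [ChartedSpace (EuclideanHalfSpace 4) X₀]
    [IsManifold (𝓡∂ 4) ∞ X₀] (e : Base g ≃ₘ⟮𝓡∂ 4, 𝓡∂ 4⟯ X₀)
    (bX₀ : BoundaryData (𝓡∂ 4) X₀ (𝓡 3)) :
    ∃ D₀ : MultiAttachmentData h₀ (𝓡∂ 4) X₀,
      (∀ a, D₀.jA a = e (a : Base g)) ∧
      IsKasOpenBookOf g h₀ D₀ bX₀.incl
        ((boundaryOpenBook g).map ((bBase g).restrictDiffeomorph bX₀ e)) := by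
  obtain ⟨D, hjA, hK⟩ := exists_multiAttachmentData_isKasOpenBookOf_base g h₀
  refine ⟨D.map e, fun a => by rw [MultiAttachmentData.map_jA_apply, hjA], ?_⟩
  exact hK.map (D := D.map e) e (fun a => rfl)

end Literature.Geometry.Symplectic

end
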